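import Summits.BirchSwinnertonDyer.BirchSwinnertonDyer.Theorems.PrintCf2SplitBadTwoKummerUClassLevel
import Summits.BirchSwinnertonDyer.BirchSwinnertonDyer.Theorems.PrintCf2SplitBadTwoKummerUTwistedProNull
import HarnessLib

/-!
# Crux `PrintCf2.SplitBadTwoRankOneOfFacts` (stmt-BirchSwinnertonDyer-20368), skeleton v13.3 stub `stub_xRegular_two` (REG₂), R2 brick B4e-θ:
# the CLASS-LEVEL (PRO-NULL)_U for TWISTED coefficients `μ_{p^M}(θ)`, `θ` a sign character — the `θ ≠ 1` twin of
# `KummerU.exists_level_resH1Hom_eq_zero_of_local`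

Cell `bsd-print-cf2`, EXTRA WIDTH seat `bsd-line-cf2-p1-w3` g13 (prover-bsd-line-cf2-p1-w3-g13-0); `--supports stmt-BirchSwinnertonDyer-20368`
(helper, Theses-free). HONEST FRAMING: nothing here closes the crux or a registered stub; BSD is not proved by any of this; no summit
statement is proved by this seat. No definition, no named fact, no `sorry`. UNCONDITIONAL (Baker–Brumer through R1 p696581).

WHAT. The registered stub (REG₂) quantifies over ALL quadratic `θ` (LEAD g14 06:46Z), and the sign-corrected `θ₀` of -w2 g14 §8 is in general
non-trivial, so the dual Kummer tower the level lift kills has TWISTED coefficients `μ_{p^M}(θ)`: classes `y ∈ H¹(U, X)`, `U = Gal(K̄/F)`, for a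
coefficient model `ι : X ↪ K̄ˣ` with `ι(g•x) = (g•ι x)^{ε g}`, `ε = θ : Γ_K →* ℤˣ`. THIS FILE assembles, exactly as the untwisted p703858 §4 but
through the θ-descent p703424 (`KummerU.twisted_proNull_of_untwisted`) over `F′ = F·K_θ` (`Gal(K̄/F′) = {u ∈ U : ε u = 1}`, abelian over `K`):
* **`exists_level_resH1Hom_eq_zero_of_local_twisted`** — ∀ k ∃ M ≥ k: for all twisted coefficient models `ι : X ↪ K̄ˣ` (`p^M • X = 0`),
  `ι₀ : X₀ ↪ K̄ˣ` (hitting `μ_{p^k}`), equivariant level map `t` with `ι₀ ∘ t = (·)^{p^{M−k}} ∘ ι`, every class `[φ] ∈ H¹(U, X)` with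
  `conj_σ [φ] ∈ awayKer U X v` (∀ σ), `conj_σ [φ] ∈ unramifiedKer U X w` (∀ σ, ∀ `w ∉ {v, v̄}`) and whose Kummer element `b′ ∈ F′` (read on
  `Gal(K̄/F′)`, where the cocycle is untwisted) has `p^M ∣ ord_{w′}(b′)` at the places of `F′` above `v̄`, has `resH1Hom id t [φ] = 0`.
  The level is `M = M_{F′}(k + e)` with `p^e ∥ #μ(F′)` (`exists_pow_prime_pow_eq_one_of_forall_galFixing_smul_eq`).
presearch: as p703424/p703858 — inflation–restriction along `U/U′ ≅ ℤ/2` + Kummer; tree assembly, no new fact. beyond-print theorem: no.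

References: [deShalit1987] III.2.3; [SerreLocalFields1979] X §3 b); [NeukirchSchmidtWingberg2008] (1.6.6)–(1.6.7), I §5.
-/

noncomputable section

set_option linter.dupNamespace false
set_option autoImplicit false

open scoped Classical
open Field NumberField IsDedekindDomain
open Literature.NumberTheory.EllipticCurves Literature.NumberTheory.EllipticCurves.GreenbergSelmer
open Literature.NumberTheory.EllipticCurves.GreenbergVatsal2000
open Literature.NumberTheory.GaloisRepresentations Literature.NumberTheory.GaloisRepresentations.LocalWeilDatum
open Summit.BirchSwinnertonDyer.BirchSwinnertonDyer.Theorems.PrintCf2.UpperBaseLift (mem_unramifiedKer_iff_resOfLe_inf_inertia_eq_zero)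

namespace Summit.BirchSwinnertonDyer.BirchSwinnertonDyer.Theorems.PrintCf2.KummerU

variable {K : Type} [Field K] [NumberField K] {p : ℕ} [Fact p.Prime]

/-- **CLASS-LEVEL (PRO-NULL)_U FOR TWISTED COEFFICIENTS `μ(θ)`.** See the module docstring. `F ⊆ F′ ⊆ K̄`, `U = Gal(K̄/F)`, `U′ = Gal(K̄/F′) =
{u ∈ U : ε u = 1}` (three inclusions), `F′/K` finite abelian, `K` imaginary quadratic, `p = v v̄`.
[cite: deShalit1987, III.2.3 (Theorem (Baker–Brumer))] [cite: SerreLocalFields1979, X §3 b)] [cite: NeukirchSchmidtWingberg2008, (1.6.6)–(1.6.7)] -/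
theorem exists_level_resH1Hom_eq_zero_of_local_twisted (hK : IsImaginaryQuadratic K) {v vbar : HeightOneSpectrum (𝓞 K)}
    (hv : ((p : ℕ) : 𝓞 K) ∈ v.asIdeal) (hvbar : ((p : ℕ) : 𝓞 K) ∈ vbar.asIdeal) (hne : vbar ≠ v)
    (F F' : IntermediateField K (AlgebraicClosure K)) [FiniteDimensional K F'] [IsAbelianGalois K F'] [NumberField F']
    [(galFixing K F).Normal] [(galFixing K F').Normal] (ε : absoluteGaloisGroup K →* ℤˣ)
    (hU' : galFixing K F' ≤ galFixing K F) (hεU' : ∀ u ∈ galFixing K F', ε u = 1)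
    (hker : ∀ u ∈ galFixing K F, ε u = 1 → u ∈ galFixing K F') (k : ℕ) :
    ∃ M : ℕ, k ≤ M ∧
      ∀ {X : Type} [AddCommGroup X] [DistribMulAction (absoluteGaloisGroup K) X] [TopologicalSpace X] [DiscreteTopology X]
        {X₀ : Type} [AddCommGroup X₀] [DistribMulAction (absoluteGaloisGroup K) X₀] [TopologicalSpace X₀] [DiscreteTopology X₀]
        (ι : X →+ Additive (AlgebraicClosure K)ˣ) (_ : Function.Injective ι)
        (_ : ∀ (g : absoluteGaloisGroup K) (x : X), Additive.toMul (ι (g • x)) = (g • Additive.toMul (ι x)) ^ ((ε g : ℤˣ) : ℤ))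
        (_ : ∀ x : X, p ^ M • x = 0)
        (ι₀ : X₀ →+ Additive (AlgebraicClosure K)ˣ) (_ : Function.Injective ι₀)
        (_ : ∀ (g : absoluteGaloisGroup K) (x : X₀), Additive.toMul (ι₀ (g • x)) = (g • Additive.toMul (ι₀ x)) ^ ((ε g : ℤˣ) : ℤ))
        (_ : ∀ m : (AlgebraicClosure K)ˣ, m ^ p ^ k = 1 → ∃ a₀ : X₀, Additive.toMul (ι₀ a₀) = m)
        (t : X →+ X₀) (ht : ∀ (g : absoluteGaloisGroup K) (x : X), t (g • x) = g • t x)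
        (_ : ∀ x : X, Additive.toMul (ι₀ (t x)) = Additive.toMul (ι x) ^ p ^ (M - k))
        (φ : contOneCocycles (discreteTopRep (galFixing K F) X)),
        (∀ σ : absoluteGaloisGroup K, conjH1 (galFixing K F) X σ (oneCocycleClass _ φ) ∈ awayKer (galFixing K F) X v) →
        (∀ w : HeightOneSpectrum (𝓞 K), w ≠ v → w ≠ vbar →
          ∀ σ : absoluteGaloisGroup K, conjH1 (galFixing K F) X σ (oneCocycleClass _ φ) ∈ unramifiedKer (galFixing K F) X w) →
        (∀ β : (AlgebraicClosure K)ˣ,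
          (∀ u : galFixing K F', Additive.toMul (ι (φ.1 ⟨u, hU' u.2⟩)) = (u : absoluteGaloisGroup K) • β / β) →
          ∀ b : F', ((b : F') : AlgebraicClosure K) = ((β ^ p ^ M : (AlgebraicClosure K)ˣ) : AlgebraicClosure K) →
          ∀ w' : vbar.Extension (𝓞 F'), ((p ^ M : ℕ) : ℤ) ∣ WithZero.log (w'.1.valuation F' b)) →
        resH1Hom (ContinuousMonoidHom.id (galFixing K F)) t (fun g x ↦ ht g x) (oneCocycleClass _ φ) = 0 := by
  have hp : p.Prime := Fact.out
  -- the shift `e` for `F′` and the level `M = M_{F′}(k + e)`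
  obtain ⟨e, he⟩ := exists_pow_prime_pow_eq_one_of_forall_galFixing_smul_eq (K := K) F' hp
  obtain ⟨M, hkeM, hM⟩ := exists_level_forall_exists_pow_eq_of_galois' (p := p) hK hv hvbar hne F' (k + e)
  refine ⟨M, le_trans (Nat.le_add_right k e) hkeM, ?_⟩
  intro X _ _ _ _ X₀ _ _ _ _ ι hιinj hι hX ι₀ hι₀inj hι₀ hι₀surj t ht htι φ hloc hunr hbar
  -- §1: the attached twisted cocycle `c : Γ_K → K̄ˣ` on `U`
  obtain ⟨c, hc, hcc, hcM⟩ := exists_twistedCocycle_of_oneCocycle (galFixing K F) ε ι hι φ hX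
  -- Kummer over `U′ = Gal(K̄/F′)` (untwisted there): `c = ∂β` on `U′`, `β^{p^M} = b′ ∈ F′`
  have hcoc : ∀ g h : galFixing K F', (fun g : galFixing K F' ↦ c g) (g * h) =
      (fun g : galFixing K F' ↦ c g) g * (g : absoluteGaloisGroup K) • (fun g : galFixing K F' ↦ c g) h := by
    intro g h
    simp only [Subgroup.coe_mul]
    rw [hcc g (hU' g.2) h (hU' h.2), hεU' g g.2, Units.val_one, zpow_one]
  have hopen : IsOpen {g : galFixing K F' | (fun g : galFixing K F' ↦ c g) g = 1} := by
    have h0 : {g : galFixing K F' | (fun g : galFixing K F' ↦ c g) g = 1} =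
        (fun g : galFixing K F' ↦ φ.1 ⟨g, hU' g.2⟩) ⁻¹' {0} := by
      ext g
      simp only [Set.mem_setOf_eq, Set.mem_preimage, Set.mem_singleton_iff, hc g (hU' g.2)]
      constructor
      · intro h
        apply hιinj
        rw [map_zero]
        exact Additive.toMul.injective (by rw [h, toMul_zero])
      · intro h
        rw [h, map_zero, toMul_zero]
    rw [h0]
    exact (isOpen_discrete _).preimage (φ.1.continuous.comp (continuous_inclusion hU'))
  have hn : ∀ g : galFixing K F', (fun g : galFixing K F' ↦ c g) g ^ p ^ M = 1 := fun g ↦ hcM g (hU' g.2)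
  obtain ⟨β, b, hb, hcβ⟩ := galFixing.exists_kummer_of_cocycle_charZero F' (p ^ M) _ hcoc hopen hn
  have hres : ∀ u ∈ galFixing K F', c u = u • β / β := fun u hu ↦ hcβ ⟨u, hu⟩
  have hβM : ((β : AlgebraicClosure K)) ^ p ^ M = ((b : F') : AlgebraicClosure K) := hb.symm
  have hb0 : b ≠ 0 := by
    intro h0
    rw [h0] at hb
    exact (β ^ p ^ M).ne_zero (by rw [Units.val_pow_eq_pow_val]; exact hb.symm.trans (map_zero _))
  -- §2: root forms at `v` and off `v, v̄`, on `U′`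
  have hrootv : ∀ σ : absoluteGaloisGroup K, ∃ β' : AlgebraicClosure K, β' ^ p ^ M = ((b : F') : AlgebraicClosure K) ∧
      ∀ τ : absoluteGaloisGroup K, τ ∈ galFixing K F' → σ * τ * σ⁻¹ ∈ decomp v → τ • β' = β' := by
    intro σ
    obtain ⟨β', hβ', hfix⟩ := exists_root_fixed_of_resOfLe_conjH1_eq_zero hι φ hX hc hU' hεU' hres (decomp v) σ (hloc σ)
    refine ⟨(β' : AlgebraicClosure K), ?_, fun τ hτ hτD ↦ ?_⟩
    · rw [← hβM, ← Units.val_pow_eq_pow_val, hβ', Units.val_pow_eq_pow_val]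
    · rw [← Units.coe_smul, hfix τ hτ hτD]
  have hrootw : ∀ w : HeightOneSpectrum (𝓞 K), w ≠ v → w ≠ vbar → ∀ σ : absoluteGaloisGroup K,
      ∃ β' : AlgebraicClosure K, β' ^ p ^ M = ((b : F') : AlgebraicClosure K) ∧
        ∀ τ : absoluteGaloisGroup K, τ ∈ galFixing K F' → σ * τ * σ⁻¹ ∈ GreenbergSelmer.inertia w → τ • β' = β' := by
    intro w hwv hwvbar σ
    have h0 := (mem_unramifiedKer_iff_resOfLe_inf_inertia_eq_zero (H := galFixing K F) (w := w) _).1 (hunr w hwv hwvbar σ)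
    obtain ⟨β', hβ', hfix⟩ := exists_root_fixed_of_resOfLe_conjH1_eq_zero hι φ hX hc hU' hεU' hres
      (GreenbergSelmer.inertia w) σ h0
    refine ⟨(β' : AlgebraicClosure K), ?_, fun τ hτ hτI ↦ ?_⟩
    · rw [← hβM, ← Units.val_pow_eq_pow_val, hβ', Units.val_pow_eq_pow_val]
    · rw [← Units.coe_smul, hfix τ hτ hτI]
  have hbar' : ∀ w' : vbar.Extension (𝓞 F'), ((p ^ M : ℕ) : ℤ) ∣ WithZero.log (w'.1.valuation F' b) :=
    hbar β (fun u ↦ by rw [← hc u (hU' u.2)]; exact hcβ u) b (by rw [Units.val_pow_eq_pow_val]; exact hb)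
  -- B4d′ over `F′` at level `k + e`
  obtain ⟨y₀, hy₀⟩ := hM b hb0 hrootv hrootw hbar'
  have hy₀0 : y₀ ≠ 0 := by
    intro h0
    rw [h0, zero_pow (pow_ne_zero _ hp.ne_zero)] at hy₀
    exact hb0 hy₀.symm
  have hβy : (β : AlgebraicClosure K) ^ p ^ M = ((y₀ : F') : AlgebraicClosure K) ^ p ^ (k + e) := by
    rw [hβM, ← hy₀]
    rfl
  -- θ-descent: `c^{p^{M−k}}` is a twisted coboundary of a `p^k`-th root of unity on `U`
  have hres' : ∀ u ∈ galFixing K F', ((c u : (AlgebraicClosure K)ˣ) : AlgebraicClosure K) =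
      u • (β : AlgebraicClosure K) / β := fun u hu ↦ by
    rw [hres u hu, Units.val_div_eq_div_val, Units.coe_smul]
  obtain ⟨m, hmk, hcob⟩ := twisted_proNull_of_untwisted F' he hU' hεU' hker hcc hkeM hcM β.ne_zero hres' hy₀0 hβy
  -- §3: the pushed class vanishes
  exact resH1Hom_id_eq_zero_of_twistedCoboundary ι₀ hι₀inj hι₀ t ht htι φ hc (hι₀surj m hmk) hcob

end Summit.BirchSwinnertonDyer.BirchSwinnertonDyer.Theorems.PrintCf2.KummerU

end
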